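import Mathlib
import HarnessLib
import Summits.NavierStokesRegularity.NavierStokesRegularity.Theorems.PeepholeEchoDoorTwisted

/-!
# PeepholeEchoDoorTwistedDoors — S23 «PeepholeEchoDoor» ADDENDUM-22R (twisted echoes), part 6/7

§6.3–6.6: K1-R PROVED (`localPointZoomTwisted_holds`, `_decay`), twisted residue algebra (`HasTwistedSymmetry.inv/.mul` declared `_root_.…PeepholeEchoDoorTwisted.HasTwistedSymmetry.*`, `eq_zero_of_twisted_lt`, `offDiagonalTwistedResidue_holds`, `hasTwoPointSymmetry_all_of_commonTwist`), the bridge `isRotatedDSS_pastCut` / `echoResidueDecayAtR_of_wall` to the wall's rotated half `RotatedTypeIDSSLiouville (√κ)⁻¹ R⁻¹`, and the doors T1-R `targetOffDiagonalTwisted_holds`, T2-R `targetCommonTwistAllRatios_holds`, T4-DR `closesEchoDecayAtR` / `targetEchoDecayR_of_wall` / `targetEchoDecayR_of_conjecture` (FULL canonical leaf ⇒ no single twisted echo), `targetEchoDecayR_refl_iff`.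

Door family of LADDER-NS N0; THEOREMS-ONLY landing of the nsreg-p1 design `run/shared/lean/pub/ns-regularity-ideate/ns-regularity-ideate-p1/r22/Sketch23R.lean`
(ADDENDUM-22R.md). Conditional door theorems: T1-R/T2-R EVADE hard core 10661 by hypothesis, T4-DR MEETS it at the named wall (rotated half);
no route, no items (DIRECTOR-NS standing #32 (2)). WHAT THIS IS NOT: not a regularity claim; not an attack on `RotatedTypeIDSSLiouville`.
-/

noncomputable section

set_option linter.dupNamespace false

namespace Summit.NavierStokesRegularity.NavierStokesRegularity.Theorems.PeepholeEchoDoorTwistedDoors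

open MeasureTheory Set Function Filter Topology TopologicalSpace Metric
open scoped RealInnerProductSpace NNReal ENNReal Topology Pointwise
open Literature.Analysis Literature.Analysis.FluidPDE
open Summit.NavierStokesRegularity.NavierStokesRegularity.Theorems.LocalSineTubeDoorProfileAlignedWindowRigidityAncient
open Summit.NavierStokesRegularity.NavierStokesRegularity.Theorems.PoloidalWindowDoorPoloidalWindowRigidityStrata
open Summit.NavierStokesRegularity.NavierStokesRegularity.Theorems.PoloidalWindowDoorPoloidalWindowRigidityFlat
open Summit.NavierStokesRegularity.NavierStokesRegularity.Theorems.PoloidalWindowDoorPoloidalWindowRigidityWindow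
open Summit.NavierStokesRegularity.NavierStokesRegularity.Theorems.PeepholeEchoDoorDefs
open Summit.NavierStokesRegularity.NavierStokesRegularity.Theorems.PeepholeEchoDoorCore
open Summit.NavierStokesRegularity.NavierStokesRegularity.Theorems.PeepholeEchoDoorResidues
open Summit.NavierStokesRegularity.NavierStokesRegularity.Theorems.PeepholeEchoDoorDoors
open Summit.NavierStokesRegularity.NavierStokesRegularity.Theorems.PeepholeEchoDoorTwisted

section Twisted

variable {ν T : ℝ} {u : ℝ → EuclideanSpace ℝ (Fin 3) → EuclideanSpace ℝ (Fin 3)} {p : ℝ → EuclideanSpace ℝ (Fin 3) → ℝ}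
  {x₀ : EuclideanSpace ℝ (Fin 3)} {C : ℝ} {v : ℝ → EuclideanSpace ℝ (Fin 3) → EuclideanSpace ℝ (Fin 3)} {lam : ℕ → ℝ}

/-! ### §6.3 K1-R proved -/

/-- **K1-R PROVED**: the universal twisted two-time zoom `LocalPointZoomTwisted` (tree velocity zoom `localPointZoomVelSlices` +
`twoTime_windowLimitR` + `hasTwistedSymmetry_of_window`). -/
theorem localPointZoomTwisted_holds : LocalPointZoomTwisted := by
  intro ν T hν hT u p hcl hLH hdec x₀ ρ M hρ hM hnot
  obtain ⟨C, v, lam, hlam, hlam0, ⟨hrate, hcont, hmild, hdiv⟩, hsing, hconv⟩ :=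
    Summit.NavierStokesRegularity.NavierStokesRegularity.Theorems.LocalVelCompTubeDoorLocalPointZoomVelSlices.localPointZoomVelSlices
      ν T hν hT u p hcl hLH hdec x₀ ρ M hρ hM hnot
  refine ⟨C, v, hrate, hcont, hmild, hdiv, hsing, fun κ μ hκ _ R U hU hUne hfade => ?_⟩
  have hslice : ∀ s < 0, Continuous (v s) := fun s hs => by
    rw [← continuousOn_univ]
    exact (analyticOnNhd_slice hcont (bdd_of_hasTypeITimeDecay hrate) hmild hs).continuousOn
  exact hasTwistedSymmetry_of_window hrate hcont hmild hν hκ R hU hUne fun s hs y hy =>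
    twoTime_windowLimitR hν hT hcl hlam hlam0 hslice hconv hκ R hU hfade hs hy

/-- K1-R with a SPACE–time local Type-I hypothesis, delivering the decay `‖v(s,z)‖ ≤ (M/ν)/(‖z‖ + √(−s))` as well. -/
theorem localPointZoomTwisted_decay (ν T : ℝ) (hν : 0 < ν) (hT : 0 < T)
    (u : ℝ → EuclideanSpace ℝ (Fin 3) → EuclideanSpace ℝ (Fin 3)) (p : ℝ → EuclideanSpace ℝ (Fin 3) → ℝ)
    (hcl : IsClassicalNSSolutionOn (Set.Ico 0 T) ν 0 u p) (hLH : IsLerayHopfOn T ν 0 (u 0) u)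
    (hdec : HasRapidSpatialDecay (u 0)) (x₀ : EuclideanSpace ℝ (Fin 3)) (ρ M : ℝ) (hρ : 0 < ρ)
    (hM : ∀ t ∈ Set.Ico 0 T, T - ρ ^ 2 < t → ∀ x ∈ Metric.ball x₀ ρ, ‖u t x‖ * (‖x - x₀‖ + Real.sqrt (ν * (T - t))) ≤ M)
    (hnot : ¬ IsBackwardBoundedAt u T x₀) :
    ∃ (C : ℝ) (v : ℝ → EuclideanSpace ℝ (Fin 3) → EuclideanSpace ℝ (Fin 3)), HasTypeITimeDecay C v ∧ HasTypeIDecay (M / ν) v ∧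
      ContinuousOn (Function.uncurry v) (Set.Iio (0 : ℝ) ×ˢ Set.univ) ∧
      (∀ s t : ℝ, s < t → t < 0 → ∀ x, v t x = UnboundedOperators.heatExtension (v s) (t - s) x - oseenDuhamel 1 s v v t x) ∧
      (∀ t < 0, VectorCalculus.IsDivFree (v t)) ∧ IsBackwardSingularPoint v 0 ∧
      ∀ (κ μ : ℝ), 0 < κ → 0 < μ → ∀ (R : EuclideanSpace ℝ (Fin 3) ≃ₗᵢ[ℝ] EuclideanSpace ℝ (Fin 3))
        (U : Set (EuclideanSpace ℝ (Fin 3))), IsOpen U → U.Nonempty →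
        DefectFadesR T x₀ u κ μ R U → HasTwistedSymmetry κ μ R v := by
  obtain ⟨C, v, lam, hlam, hlam0, ⟨hrate, hcont, hmild, hdiv⟩, hsing, hconv⟩ :=
    Summit.NavierStokesRegularity.NavierStokesRegularity.Theorems.LocalVelCompTubeDoorLocalPointZoomVelSlices.localPointZoomVelSlices
      ν T hν hT u p hcl hLH hdec x₀ ρ M hρ
      (Summit.NavierStokesRegularity.NavierStokesRegularity.Theorems.PlaneStrainDoorZoomSpaceTimeDecay.timeTypeI_of_spaceTimeTypeI hM)
      hnot
  have hdecay : HasTypeIDecay (M / ν) v :=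
    Summit.NavierStokesRegularity.NavierStokesRegularity.Theorems.PlaneStrainDoorZoomSpaceTimeDecay.hasTypeIDecay_of_zoom
      hν hT hρ hlam hlam0 hM hconv
  refine ⟨C, v, hrate, hdecay, hcont, hmild, hdiv, hsing, fun κ μ hκ _ R U hU hUne hfade => ?_⟩
  have hslice : ∀ s < 0, Continuous (v s) := fun s hs => by
    rw [← continuousOn_univ]
    exact (analyticOnNhd_slice hcont (bdd_of_hasTypeITimeDecay hrate) hmild hs).continuousOn
  exact hasTwistedSymmetry_of_window hrate hcont hmild hν hκ R hU hUne fun s hs y hy =>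
    twoTime_windowLimitR hν hT hcl hlam hlam0 hslice hconv hκ R hU hfade hs hy

/-! ### §6.4 Twisted residue algebra -/

/-- Inversion: a `(κ, μ, R)` symmetry is a `(κ⁻¹, μ⁻¹, R⁻¹)` symmetry. -/
theorem _root_.Summit.NavierStokesRegularity.NavierStokesRegularity.Theorems.PeepholeEchoDoorTwisted.HasTwistedSymmetry.inv {κ μ : ℝ} {R : EuclideanSpace ℝ (Fin 3) ≃ₗᵢ[ℝ] EuclideanSpace ℝ (Fin 3)}
    (hκ : 0 < κ) (hμ : 0 < μ) (h : HasTwistedSymmetry κ μ R v) : HasTwistedSymmetry κ⁻¹ μ⁻¹ R.symm v := by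
  intro s hs z
  have hκs : κ⁻¹ * s < 0 := mul_neg_of_pos_of_neg (inv_pos.2 hκ) hs
  have h1 := h (κ⁻¹ * s) hκs (μ⁻¹ • R.symm z)
  rw [← mul_assoc, mul_inv_cancel₀ hκ.ne', one_mul, LinearIsometryEquiv.map_smul, smul_smul,
    mul_inv_cancel₀ hμ.ne', one_smul, LinearIsometryEquiv.apply_symm_apply] at h1
  rw [LinearIsometryEquiv.symm_symm, h1, LinearIsometryEquiv.map_smul, LinearIsometryEquiv.apply_symm_apply, smul_smul,
    inv_mul_cancel₀ hμ.ne', one_smul]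

/-- Composition: `(κ₁, μ₁, R₁)` then `(κ₂, μ₂, R₂)` give `(κ₁κ₂, μ₁μ₂, R₁ ≫ R₂)` (`R₁.trans R₂`). -/
theorem _root_.Summit.NavierStokesRegularity.NavierStokesRegularity.Theorems.PeepholeEchoDoorTwisted.HasTwistedSymmetry.mul {κ₁ μ₁ κ₂ μ₂ : ℝ} {R₁ R₂ : EuclideanSpace ℝ (Fin 3) ≃ₗᵢ[ℝ] EuclideanSpace ℝ (Fin 3)}
    (hκ₁ : 0 < κ₁) (h₁ : HasTwistedSymmetry κ₁ μ₁ R₁ v) (h₂ : HasTwistedSymmetry κ₂ μ₂ R₂ v) :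
    HasTwistedSymmetry (κ₁ * κ₂) (μ₁ * μ₂) (R₁.trans R₂) v := by
  intro s hs z
  have hκ₁s : κ₁ * s < 0 := mul_neg_of_pos_of_neg hκ₁ hs
  rw [h₁ s hs z, h₂ (κ₁ * s) hκ₁s (μ₁ • R₁ z), LinearIsometryEquiv.map_smul, smul_smul, LinearIsometryEquiv.map_smul,
    smul_smul, show κ₂ * (κ₁ * s) = κ₁ * κ₂ * s by ring, mul_comm μ₂ μ₁]
  rfl

/-- **OFF-DIAGONAL TWISTED RESIDUE, contracting case** `μ² < κ`: the rate kills the profile (norm induction). -/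
theorem eq_zero_of_twisted_lt {κ μ : ℝ} {R : EuclideanSpace ℝ (Fin 3) ≃ₗᵢ[ℝ] EuclideanSpace ℝ (Fin 3)}
    (hκ : 0 < κ) (hμ : 0 < μ) (hlt : μ ^ 2 < κ)
    (hrate : HasTypeITimeDecay C v) (h : HasTwistedSymmetry κ μ R v) : ∀ t < 0, ∀ x, v t x = 0 := by
  set r : ℝ := μ / Real.sqrt κ with hr
  have hsκ : 0 < Real.sqrt κ := Real.sqrt_pos.2 hκ
  have hr0 : 0 ≤ r := div_nonneg hμ.le hsκ.le
  have hr1 : r < 1 := by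
    rw [hr, div_lt_one hsκ]
    have : μ = Real.sqrt (μ ^ 2) := (Real.sqrt_sq hμ.le).symm
    rw [this]
    exact Real.sqrt_lt_sqrt (sq_nonneg μ) hlt
  have hbound : ∀ n : ℕ, ∀ t < 0, ∀ x, ‖v t x‖ ≤ C / Real.sqrt (-t) * r ^ n := by
    intro n
    induction n with
    | zero =>
      intro t ht x
      simpa using hrate t ht x
    | succ n ih =>
      intro t ht x
      have hκt : κ * t < 0 := mul_neg_of_pos_of_neg hκ ht
      have hnt : 0 < -t := neg_pos.2 ht
      rw [h t ht x, norm_smul, Real.norm_of_nonneg hμ.le, LinearIsometryEquiv.norm_map]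
      have h1 := ih (κ * t) hκt (μ • R x)
      have hsq : Real.sqrt (-(κ * t)) = Real.sqrt κ * Real.sqrt (-t) := by
        rw [show -(κ * t) = κ * (-t) by ring, Real.sqrt_mul hκ.le]
      rw [hsq] at h1
      have hst : 0 < Real.sqrt (-t) := Real.sqrt_pos.2 hnt
      calc μ * ‖v (κ * t) (μ • R x)‖ ≤ μ * (C / (Real.sqrt κ * Real.sqrt (-t)) * r ^ n) :=
            mul_le_mul_of_nonneg_left h1 hμ.le
        _ = C / Real.sqrt (-t) * r ^ (n + 1) := by
            rw [hr, pow_succ]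
            field_simp
  intro t ht x
  have hlim : Tendsto (fun n : ℕ => C / Real.sqrt (-t) * r ^ n) atTop (𝓝 (C / Real.sqrt (-t) * 0)) :=
    (tendsto_pow_atTop_nhds_zero_of_lt_one hr0 hr1).const_mul _
  rw [mul_zero] at hlim
  have hle : ‖v t x‖ ≤ 0 := ge_of_tendsto' hlim fun n => hbound n t ht x
  exact norm_eq_zero.1 (le_antisymm hle (norm_nonneg _))

/-- **OFF-DIAGONAL TWISTED RESIDUE** (both cases, by inversion). -/
theorem offDiagonalTwistedResidue_holds : OffDiagonalTwistedResidue := by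
  intro κ μ hκ hμ hne R C v hrate h
  rcases lt_or_gt_of_ne hne with hlt | hgt
  · exact eq_zero_of_twisted_lt hκ hμ hlt hrate h
  · refine eq_zero_of_twisted_lt (inv_pos.2 hκ) (inv_pos.2 hμ) ?_ hrate (h.inv hκ hμ)
    rw [inv_pow]
    exact (inv_lt_inv₀ (by positivity) hκ).2 hgt

/-- **COMMON TWIST UNTWISTS**: twisted echoes at every ratio in `(0,1)` with one twist `R` give plain echoes at every
ratio (`(rκ₂, R) · (κ₂, R)⁻¹ = (r, 1)`). -/
theorem hasTwoPointSymmetry_all_of_commonTwist {R : EuclideanSpace ℝ (Fin 3) ≃ₗᵢ[ℝ] EuclideanSpace ℝ (Fin 3)}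
    (h : ∀ κ : ℝ, 0 < κ → κ < 1 → HasTwistedSymmetry κ (Real.sqrt κ) R v) :
    ∀ κ : ℝ, 0 < κ → HasTwoPointSymmetry κ (Real.sqrt κ) v := by
  intro r hr
  obtain ⟨κ₂, hκ₂def⟩ : ∃ κ₂ : ℝ, κ₂ = 1 / (2 * (1 + r)) := ⟨_, rfl⟩
  have hκ₂ : 0 < κ₂ := by rw [hκ₂def]; positivity
  have hκ₂1 : κ₂ < 1 := by
    rw [hκ₂def, div_lt_one (by positivity)]
    linarith
  have hκ₁ : 0 < r * κ₂ := mul_pos hr hκ₂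
  have hκ₁1 : r * κ₂ < 1 := by
    rw [hκ₂def, show r * (1 / (2 * (1 + r))) = r / (2 * (1 + r)) by ring, div_lt_one (by positivity)]
    linarith
  have h12 := (h (r * κ₂) hκ₁ hκ₁1).mul hκ₁ ((h κ₂ hκ₂ hκ₂1).inv hκ₂ (Real.sqrt_pos.2 hκ₂))
  rw [mul_inv_cancel_right₀ hκ₂.ne', LinearIsometryEquiv.self_trans_symm] at h12
  have hs : Real.sqrt (r * κ₂) * (Real.sqrt κ₂)⁻¹ = Real.sqrt r := by
    rw [Real.sqrt_mul hr.le, mul_inv_cancel_right₀ (Real.sqrt_pos.2 hκ₂).ne']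
  rw [hs] at h12
  exact (hasTwistedSymmetry_refl_iff r (Real.sqrt r)).1 h12

/-! ### §6.5 The twisted echo residue from the wall's rotated half -/

/-- A twisted echo at ratio `κ ∈ (0,1)` with twist `R` makes the past-cut field rotated-DSS with factor `(√κ)⁻¹` and
rotation `R⁻¹` (tree convention `IsRotatedDSS c R u : c • R.symm (u (c² t) (c • R x)) = u t x`). -/
theorem isRotatedDSS_pastCut {κ : ℝ} {R : EuclideanSpace ℝ (Fin 3) ≃ₗᵢ[ℝ] EuclideanSpace ℝ (Fin 3)} (hκ : 0 < κ)
    (h : HasTwistedSymmetry κ (Real.sqrt κ) R v) : IsRotatedDSS (Real.sqrt κ)⁻¹ R.symm (pastCut v) := by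
  have hsκ : 0 < Real.sqrt κ := Real.sqrt_pos.2 hκ
  have hc2 : ((Real.sqrt κ)⁻¹) ^ 2 = κ⁻¹ := by rw [inv_pow, Real.sq_sqrt hκ.le]
  have hinv := h.inv hκ hsκ
  intro t x
  rw [hc2]
  by_cases ht : t < 0
  · have hκt : κ⁻¹ * t < 0 := mul_neg_of_pos_of_neg (inv_pos.2 hκ) ht
    rw [pastCut_of_neg ht, pastCut_of_neg hκt]
    exact (hinv t ht x).symm
  · have hκt : ¬ κ⁻¹ * t < 0 := fun h' => ht (by
      rcases lt_or_ge t 0 with h1 | h1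
      · exact h1
      · exact absurd h' (not_lt.2 (mul_nonneg (inv_pos.2 hκ).le h1)))
    rw [pastCut_of_not_neg ht, pastCut_of_not_neg hκt]
    simp

/-- **BRIDGE TO THE WALL'S ROTATED HALF (PROVED).**  For `κ ∈ (0,1)` and any twist `R`,
`RotatedTypeIDSSLiouville (√κ)⁻¹ R⁻¹` (tree `Literature.Analysis.FluidPDE.RotatedTypeIDSSLiouville`, Bradshaw–Tsai OP 5.1
for RDSS fields) implies the twisted echo residue in the decay class at every decay constant. -/
theorem echoResidueDecayAtR_of_wall {κ : ℝ} (hκ : 0 < κ) (hκ1 : κ < 1)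
    (R : EuclideanSpace ℝ (Fin 3) ≃ₗᵢ[ℝ] EuclideanSpace ℝ (Fin 3))
    (hwall : RotatedTypeIDSSLiouville (Real.sqrt κ)⁻¹ R.symm) (D : ℝ) : EchoResidueDecayAtR D κ R := by
  intro C v hrate hdecay hcont hmild hdiv hsym hsing
  have hsκ : 0 < Real.sqrt κ := Real.sqrt_pos.2 hκ
  have hsκ1 : Real.sqrt κ < 1 := by
    have h := Real.sqrt_lt_sqrt hκ.le hκ1
    rwa [Real.sqrt_one] at h
  have hc1 : 1 < (Real.sqrt κ)⁻¹ := (one_lt_inv₀ hsκ).2 hsκ1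
  have hclass : IsTypeIAncientMild C (pastCut v) :=
    isTypeIAncientMild_pastCut (isTypeIAncientMild_of_class hrate hcont hmild hdiv)
  have hmeas : ∀ t < 0, AEStronglyMeasurable (pastCut v t) volume := by
    intro t ht
    rw [pastCut_of_neg ht]
    have hc : Continuous (v t) := by
      rw [← continuousOn_univ]
      exact (analyticOnNhd_slice hcont (bdd_of_hasTypeITimeDecay hrate) hmild ht).continuousOn
    exact hc.aestronglyMeasurable
  have hdec' : ∃ C₀ : ℝ, HasTypeIDecay C₀ (pastCut v) :=
    ⟨D, fun t ht x => by rw [pastCut_of_neg ht]; exact hdecay t ht x⟩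
  have hae := hwall hc1 (pastCut v) hclass.isAncientMildSolution hmeas (isRotatedDSS_pastCut hκ hsym) hdec'
  have hae' : ∀ t < 0, v t =ᵐ[volume] 0 := fun t ht => by
    have h := hae t ht
    rwa [pastCut_of_neg ht] at h
  exact not_backwardSingular_of_zero (eq_zero_of_ae hrate hcont hmild hae') hsing

/-- The same for every decay constant. -/
theorem echoResidueDecayR_of_wall {κ : ℝ} (hκ : 0 < κ) (hκ1 : κ < 1)
    (R : EuclideanSpace ℝ (Fin 3) ≃ₗᵢ[ℝ] EuclideanSpace ℝ (Fin 3))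
    (hwall : RotatedTypeIDSSLiouville (Real.sqrt κ)⁻¹ R.symm) : EchoResidueDecayR κ R :=
  fun D => echoResidueDecayAtR_of_wall hκ hκ1 R hwall D

/-! ### §6.6 The twisted doors -/

/-- **DOOR T1-R (PROVED).** -/
theorem targetOffDiagonalTwisted_holds : TargetOffDiagonalTwisted := by
  intro ν T hν hT u p hcl hLH hdec x₀ ρ M hρ hM κ μ hκ hμ hne R U hU hUne hfade
  by_contra hnot
  obtain ⟨C, v, hrate, hcont, hmild, hdiv, hsing, huniv⟩ :=
    localPointZoomTwisted_holds ν T hν hT u p hcl hLH hdec x₀ ρ M hρ hM hnot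
  have hsym := huniv κ μ hκ hμ R U hU hUne hfade
  exact not_backwardSingular_of_zero (offDiagonalTwistedResidue_holds κ μ hκ hμ hne R C v hrate hsym) hsing

/-- **DOOR T2-R (PROVED).** -/
theorem targetCommonTwistAllRatios_holds : TargetCommonTwistAllRatios := by
  intro ν T hν hT u p hcl hLH hdec x₀ ρ M hρ hM R hall
  by_contra hnot
  obtain ⟨C, v, hrate, hcont, hmild, hdiv, hsing, huniv⟩ :=
    localPointZoomTwisted_holds ν T hν hT u p hcl hLH hdec x₀ ρ M hρ hM hnot
  have hsym : ∀ κ : ℝ, 0 < κ → κ < 1 → HasTwistedSymmetry κ (Real.sqrt κ) R v := by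
    intro κ hκ hκ1
    obtain ⟨U, hU, hUne, hfade⟩ := hall κ hκ hκ1
    exact huniv κ (Real.sqrt κ) hκ (Real.sqrt_pos.2 hκ) R U hU hUne hfade
  exact allRatiosResidue_holds C v hrate hcont hmild hdiv (hasTwoPointSymmetry_all_of_commonTwist hsym) hsing

/-- The twisted decay door at constants `ν, M`: PROVED modulo `EchoResidueDecayAtR (M/ν) κ R`. -/
theorem closesEchoDecayAtR (ν M κ : ℝ) (R : EuclideanSpace ℝ (Fin 3) ≃ₗᵢ[ℝ] EuclideanSpace ℝ (Fin 3)) (hν : 0 < ν)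
    (hκ : 0 < κ) (h₂ : EchoResidueDecayAtR (M / ν) κ R) : TargetEchoDecayAtR ν M κ R := by
  intro T hT u p hcl hLH hdec x₀ ρ hρ hM U hU hUne hfade
  by_contra hnot
  obtain ⟨C, v, hrate, hdecay, hcont, hmild, hdiv, hsing, huniv⟩ :=
    localPointZoomTwisted_decay ν T hν hT u p hcl hLH hdec x₀ ρ M hρ hM hnot
  exact h₂ C v hrate hdecay hcont hmild hdiv (huniv κ (Real.sqrt κ) hκ (Real.sqrt_pos.2 hκ) R U hU hUne hfade) hsing

/-- The twisted decay door: PROVED modulo `EchoResidueDecayR κ R`. -/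
theorem closesEchoDecayR (κ : ℝ) (R : EuclideanSpace ℝ (Fin 3) ≃ₗᵢ[ℝ] EuclideanSpace ℝ (Fin 3)) (hκ : 0 < κ)
    (h₂ : EchoResidueDecayR κ R) : TargetEchoDecayR κ R :=
  fun ν M hν => closesEchoDecayAtR ν M κ R hν hκ (h₂ (M / ν))

/-- **DOOR T4-DR FROM THE WALL'S ROTATED HALF (PROVED bridge):** for `κ ∈ (0,1)` and any twist `R`,
`RotatedTypeIDSSLiouville (√κ)⁻¹ R⁻¹ → TargetEchoDecayR κ R`. -/
theorem targetEchoDecayR_of_wall {κ : ℝ} (hκ : 0 < κ) (hκ1 : κ < 1)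
    (R : EuclideanSpace ℝ (Fin 3) ≃ₗᵢ[ℝ] EuclideanSpace ℝ (Fin 3))
    (hwall : RotatedTypeIDSSLiouville (Real.sqrt κ)⁻¹ R.symm) : TargetEchoDecayR κ R :=
  closesEchoDecayR κ R hκ (echoResidueDecayR_of_wall hκ hκ1 R hwall)

/-- **… hence from the canonical leaf `TypeIDSSLiouvilleConjecture` (its SECOND, rotated conjunct): the full leaf excludes
every single twisted echo at every ratio `κ ∈ (0,1)` with every twist `R ∈ O(3)`.** -/
theorem targetEchoDecayR_of_conjecture
    (h : Summit.NavierStokesRegularity.NavierStokesRegularity.TypeIDSSLiouvilleConjecture) {κ : ℝ} (hκ : 0 < κ)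
    (hκ1 : κ < 1) (R : EuclideanSpace ℝ (Fin 3) ≃ₗᵢ[ℝ] EuclideanSpace ℝ (Fin 3)) : TargetEchoDecayR κ R :=
  targetEchoDecayR_of_wall hκ hκ1 R ((h (Real.sqrt κ)⁻¹).2 R.symm)

/-- `R = 1`: the twisted decay door is the plain one (T4-D). -/
theorem targetEchoDecayR_refl_iff (κ : ℝ) :
    TargetEchoDecayR κ (LinearIsometryEquiv.refl ℝ _) ↔ TargetEchoDecay κ := Iff.rfl

end Twisted


end Summit.NavierStokesRegularity.NavierStokesRegularity.Theorems.PeepholeEchoDoorTwistedDoors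

end
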